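import Literature.NumberTheory.LFunctions.AlmostMonomialLowDegree
import Literature.RepresentationTheory.FiniteGroups.PermutationCharacter
import Literature.RepresentationTheory.FiniteGroups.ProductWithLinearCharacter
import HarnessLib

/-!
# `S₅` is almost monomial (Booker 2006, Proposition 2.3, third group) — proved

Topic `Literature/NumberTheory/LFunctions`; companion of `CertifiedArtinHolomorphyCriterion.lean`
(Booker's Definition 2.1 `Booker2006.IsAlmostMonomial`, the NAMED FACT `booker2006_proposition23`),
of `AlmostMonomialLowDegree.lean` (the engine: DM-positive virtual characters have natural degrees,
degree-`≤ 3` irreducibles never split, the degree criterion) and of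
`AlmostMonomialAlternatingFive.lean` (`A₅`).  Kernel lane: `decide` computations over the `120`
elements of `S₅`; no named fact; standard axioms.

Source: A. R. Booker, *Artin's conjecture, Turing's method, and the Riemann hypothesis*,
Experiment. Math. **15** (2006) 385–407, §2 **Proposition 2.3** (p. 390): "The groups `SL₂(𝔽₃)`,
`A₅`, and `S₅` are almost monomial" — "shown with the aid of the computer algebra system GAP".

## The proof formalised here (replacing the GAP computation)

`G = S₅` (Mathlib `Equiv.Perm (Fin 5)`), `sgn` its sign character, `G_0 ≅ S₄` a point stabiliser,
`H₂ = S₃ × S₂` the stabiliser of the partition `{0,1,2} ⊔ {3,4}` (order `12`) and `τ : H₂ → {±1}`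
the sign of the `S₂`-component.  The six MONOMIAL characters used are

* `M₁ = Ind_{G_0} 1 = #fix`, `M₁' = Ind_{G_0} sgn = sgn · M₁`,
* `M₂ = Ind_{H₂} 1` (values `10, 4, 2, 1, 0, 1, 0` on the classes `1, (2), (2,2), (3), (4), (3,2), (5)`;
  James–Liebeck's `χ_S`), `M₂' = Ind_{H₂} sgn = sgn · M₂`,
* `M₃ = Ind_{H₂} τ` (values `10, 2, −2, 1, 0, −1, 0`), `M₃' = Ind_{H₂} (τ · sgn) = sgn · M₃`

(the products by the projection formula `indClassFun_mul_restrict`; the tables of `M₂`, `M₃` are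
certified by the kernel from the defining sums, `S2_eq_TN2`, `S3_eq_TN3`).  Following James–Liebeck,
Example 19.16, the non-linear irreducible characters of `S₅` are
`ψ₄ = M₁ − 1` (`#fix − 1`, the tree's `isIrrChar_perm_natCard_fixedBy_sub_one`), `ψ₄' = sgn ψ₄`,
`ψ₅ = M₂ − 1 − ψ₄` (`⟨M₂, 1⟩ = ⟨M₂ − 1, ψ₄⟩ = ⟨ψ₅, ψ₅⟩ = 1`), `ψ₅' = sgn ψ₅`, and
`ψ₆ = M₃ − ψ₄` (`⟨M₃, ψ₄⟩ = ⟨ψ₆, ψ₆⟩ = 1`; James–Liebeck's `χ_A`), of degrees `4, 4, 5, 5, 6`; we do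
NOT need completeness of this list: an irreducible `ρ` of degree `≥ 4` different from all five is
orthogonal to every `Mᵢ` (each `Mᵢ` is a sum of `1`, `sgn` and the five), which forces `χ₁(1) = 0`
below.  For a splitting `ρ = χ₁ + χ₂` (Definition 2.1) put `nᵢ = ⟨χ₁, Mᵢ⟩, nᵢ' = ⟨χ₁, Mᵢ'⟩ ∈ ℕ`
(`≤ ⟨ρ, Mᵢ⟩`), `⟨χ₁, 1⟩ = ⟨χ₁, sgn⟩ = 0`; the kernel-checked class-function identities
`Ind_1^G 1 = −4(M₁ + M₁') + 5(M₂ + M₂') + 3(M₃ + M₃')` and `M₃ − M₃' = M₁ − M₁' − 1 + sgn` give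
`χ₁(1) = −4(n₁ + n₁') + 5(n₂ + n₂') + 3(n₃ + n₃')` and `n₃ − n₃' = n₁ − n₁'`; with
`0 ≤ χ₁(1) ≤ ρ(1)` and the thirty scalar products `⟨ψ, Mᵢ⟩` (kernel) this forces
`χ₁(1) ∈ {0, ρ(1)}` in each case, and the degree criterion
(`eq_zero_or_eq_zero_of_split_of_apply_one`) ends the proof; degree `≤ 3` is the engine.

Main results: `Booker2006.S5.isIrrChar_chi32`, `Booker2006.S5.isIrrChar_chi311` (the characters of
degrees `5`, `6` as explicit functions), **`Booker2006.isAlmostMonomial_perm_fin_five :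
IsAlmostMonomial (Equiv.Perm (Fin 5))`**.

## References

* [Booker2006] A. R. Booker, Experiment. Math. 15 (2006) 385–407, §2 Definition 2.1 (p. 389),
  Proposition 2.3 (p. 390) (journal pdf `paper:url-702ab4eacdaa`; arXiv:math/0507502 Prop. 3).
* [JamesLiebeck2001] G. James, M. Liebeck, *Representations and Characters of Groups*, 2nd ed.,
  CUP 2001, Example 19.16 (the character table of `S₅`: `χ₃ = #fix − 1`, `χ₄ = χ₃χ₂`,
  `χ₆ = χ_S − χ₁ − χ₃`, `χ₇ = χ₆χ₂`, `χ₅ = χ_A`), 29.11 (1).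
* [Isaacs1976] I. M. Isaacs, *Character Theory of Finite Groups*, Lemma 5.14 (`(1_H)^G`).
* [SerreLinearRepresentations1977] J.-P. Serre, *Linear Representations of Finite Groups*, §7.2
  Remark (3) (projection formula).
-/

noncomputable section

open scoped ComplexOrder
open Finset MulAction

namespace Literature.NumberTheory.LFunctions

namespace Booker2006

open Literature.RepresentationTheory.FiniteGroups

/-! ### General helpers (any finite group) -/

section General

variable {G : Type} [Group G] [Fintype G]

/-- Right additivity of the scalar product. [folklore] -/
private theorem classInner_add_right' (φ ψ ψ' : G → ℂ) :
    classInner φ (ψ + ψ') = classInner φ ψ + classInner φ ψ' := by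
  rw [classInner_comm, classInner_add_left, classInner_comm ψ, classInner_comm ψ']

/-- Right homogeneity of the scalar product. [folklore] -/
private theorem classInner_smul_right' (c : ℂ) (φ ψ : G → ℂ) :
    classInner φ (c • ψ) = c * classInner φ ψ := by
  rw [classInner_comm, classInner_smul_left, classInner_comm]

/-- Right subtraction for the scalar product. [folklore] -/
private theorem classInner_sub_right' (φ ψ ψ' : G → ℂ) :
    classInner φ (ψ - ψ') = classInner φ ψ - classInner φ ψ' := by
  rw [sub_eq_add_neg, classInner_add_right', ← neg_one_smul ℂ ψ', classInner_smul_right']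
  ring

/-- `⟨χ, Ind_1^G 1⟩ = χ(1)` for a class function `χ` (the regular character is monomial).
[cite: Booker2006, §2 (2–4) p. 389] -/
private theorem classInner_indClassFun_bot' (χ : G → ℂ) (hχ : IsClassFun χ) :
    classInner χ (indClassFun (⊥ : Subgroup G) fun h => ((1 : (⊥ : Subgroup G) →* ℂˣ) h : ℂ)) =
      χ 1 := by
  rw [classInner_indClassFun_right ⊥ _ hχ, classInner_apply, Fintype.card_unique,
    Fintype.sum_unique]
  have hd : (default : (⊥ : Subgroup G)) = 1 := Subsingleton.elim _ _
  rw [hd]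
  simp

/-- The regular character `Ind_1^G 1`: value `|G|` at `1` and `0` elsewhere. [folklore] -/
private theorem indClassFun_bot_apply' [DecidableEq G] (s : G) :
    indClassFun (⊥ : Subgroup G) (fun h => ((1 : (⊥ : Subgroup G) →* ℂˣ) h : ℂ)) s =
      if s = 1 then (Fintype.card G : ℂ) else 0 := by
  classical
  rw [indClassFun_apply]
  have hext : ∀ t : G, Function.extend (Subtype.val : (⊥ : Subgroup G) → G)
      (fun h => ((1 : (⊥ : Subgroup G) →* ℂˣ) h : ℂ)) 0 (t⁻¹ * s * t) = if s = 1 then 1 else 0 := by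
    intro t
    by_cases hs : s = 1
    · subst hs
      have hmem : t⁻¹ * 1 * t ∈ (⊥ : Subgroup G) := by simp
      rw [show t⁻¹ * 1 * t = ((⟨t⁻¹ * 1 * t, hmem⟩ : (⊥ : Subgroup G)) : G) from rfl,
        extend_subtypeVal_apply]
      simp
    · have hnmem : t⁻¹ * s * t ∉ (⊥ : Subgroup G) := by
        rw [Subgroup.mem_bot]
        intro h
        apply hs
        have : s = t * (t⁻¹ * s * t) * t⁻¹ := by group
        rw [this, h]; group
      rw [extend_subtypeVal_of_not_mem _ _ hnmem, if_neg hs]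
  simp only [hext, Finset.sum_const, Finset.card_univ, nsmul_eq_mul, Subgroup.card_bot,
    Nat.cast_one, inv_one, one_mul]
  split_ifs <;> simp

omit [Fintype G] in
/-- `1_G` is irreducible. [folklore] -/
private theorem isIrrChar_one'' : IsIrrChar G (1 : G → ℂ) := by
  have h := character_trivial_mem_irrChars (G := G)
  have h1 : (Representation.trivial ℂ G ℂ).character = 1 := by
    funext x; simp [Representation.character]
  rwa [h1] at h

/-- A non-empty multiset of irreducible characters sums to a character. [folklore] -/
private theorem isCharacter_multiset_sum'' :
    ∀ m : Multiset (G → ℂ), (∀ χ ∈ m, IsIrrChar G χ) → m ≠ 0 → IsCharacter G m.sum := by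
  intro m
  induction m using Multiset.induction_on with
  | empty => intro _ h; exact absurd rfl h
  | cons χ m ih =>
    intro hm _
    by_cases h0 : m = 0
    · subst h0
      simpa using (hm χ (Multiset.mem_cons_self _ _)).isCharacter
    · rw [Multiset.sum_cons]
      exact IsCharacter.add (hm χ (Multiset.mem_cons_self _ _)).isCharacter
        (ih (fun χ' h' => hm χ' (Multiset.mem_cons_of_mem h')) h0)

/-- **Peeling off a constituent of multiplicity one** (James–Liebeck 19.16, the step
`χ_S = χ₁ + χ₃ + ψ`): if `π` is a character, `α` irreducible and `⟨π, α⟩ = 1`, then `π − α` is `0` or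
a character. [cite: JamesLiebeck2001, Example 19.16] -/
private theorem sub_eq_zero_or_isCharacter {π α : G → ℂ} (hπ : IsCharacter G π) (hα : IsIrrChar G α)
    (h1 : classInner π α = 1) : π - α = 0 ∨ IsCharacter G (π - α) := by
  classical
  obtain ⟨m, hm, hsum⟩ := hπ.exists_multiset_irrChars
  have hcount : m.count α = 1 := by
    have h := classInner_multiset_sum_irrChars hm hα
    rw [← hsum, h1] at h
    exact_mod_cast h.symm
  obtain ⟨m', rfl⟩ : ∃ m', m = α ::ₘ m' :=
    Multiset.exists_cons_of_mem (Multiset.count_pos.mp (by omega))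
  have hm' : ∀ χ ∈ m', IsIrrChar G χ := fun χ h => hm χ (Multiset.mem_cons_of_mem h)
  have heq : π - α = m'.sum := by rw [hsum, Multiset.sum_cons]; abel
  rw [heq]
  by_cases h0 : m' = 0
  · left; rw [h0, Multiset.sum_zero]
  · right; exact isCharacter_multiset_sum'' m' hm' h0

/-- A function that is `0` or a character and has `⟨φ, φ⟩ = 1` is an irreducible character.
[cite: JamesLiebeck2001, Thm. 14.20] -/
private theorem isIrrChar_of_zero_or_isCharacter {φ : G → ℂ} (h : φ = 0 ∨ IsCharacter G φ)
    (h1 : classInner φ φ = 1) : IsIrrChar G φ := by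
  rcases h with rfl | h
  · rw [classInner_zero_left] at h1; exact absurd h1 zero_ne_one
  · exact h.isIrrChar_of_classInner_eq_one h1

end General

/-! ### The group `S₅` and its computable class functions -/

/-- `S₅` as a type. [cite: Booker2006, §2 Proposition 2.3 p. 390] -/
abbrev Perm5 : Type := Equiv.Perm (Fin 5)

namespace S5

/-- The number of fixed points of `g ∈ S₅` on `{0, …, 4}`. [cite: JamesLiebeck2001, Example 19.16] -/
def fixN (g : Perm5) : ℕ := (Finset.univ.filter fun i : Fin 5 => g • i = i).card

/-- The sign of `g` as an integer. [cite: JamesLiebeck2001, Example 19.16] -/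
def sgnZ (g : Perm5) : ℤ := ((Equiv.Perm.sign g : ℤˣ) : ℤ)

/-- Membership test for `H₂ = Stab({3, 4}) ≅ S₃ × S₂`. [cite: JamesLiebeck2001, Example 19.16] -/
def inH2 (g : Perm5) : Bool :=
  (decide (g 3 = 3) || decide (g 3 = 4)) && (decide (g 4 = 3) || decide (g 4 = 4))

/-- The sign `τ` of the `S₂`-component, extended to `S₅`: `+1` iff `g` fixes `3`.
[cite: JamesLiebeck2001, Example 19.16] -/
def swapU (g : Perm5) : ℤˣ := if g 3 = 3 then 1 else -1

/-- `S₂(s) = #{t ∈ S₅ : t⁻¹ s t ∈ H₂} = |H₂| · (Ind_{H₂} 1)(s)`. [cite: Isaacs1976, Lemma 5.14] -/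
def S2 (s : Perm5) : ℕ := (Finset.univ.filter fun t : Perm5 => inH2 (t⁻¹ * s * t) = true).card

/-- `S₃(s) = Σ_{t : t⁻¹ s t ∈ H₂} τ(t⁻¹ s t) = |H₂| · (Ind_{H₂} τ)(s)`. [cite: Isaacs1976, Lemma 5.14] -/
def S3 (s : Perm5) : ℤ :=
  ∑ t : Perm5, if inH2 (t⁻¹ * s * t) = true then ((swapU (t⁻¹ * s * t) : ℤˣ) : ℤ) else 0

/-- The values of `S₂ = 12 · M₂` by cycle type (read off from `#fix`, `g² = 1`, `g⁵ = 1`):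
`1 ↦ 120`, `(2) ↦ 48`, `(2,2) ↦ 24`, `(3) ↦ 12`, `(4) ↦ 0`, `(5) ↦ 0`, `(3,2) ↦ 12`.
[cite: JamesLiebeck2001, Example 19.16] -/
def TN2 (g : Perm5) : ℕ :=
  if fixN g = 5 then 120 else if fixN g = 3 then 48 else if fixN g = 2 then 12 else
  if fixN g = 1 then (if g * g = 1 then 24 else 0) else (if g ^ 5 = 1 then 0 else 12)

/-- The values of `S₃ = 12 · M₃` by cycle type:
`1 ↦ 120`, `(2) ↦ 24`, `(2,2) ↦ −24`, `(3) ↦ 12`, `(4) ↦ 0`, `(5) ↦ 0`, `(3,2) ↦ −12`.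
[cite: JamesLiebeck2001, Example 19.16] -/
def TN3 (g : Perm5) : ℤ :=
  if fixN g = 5 then 120 else if fixN g = 3 then 24 else if fixN g = 2 then 12 else
  if fixN g = 1 then (if g * g = 1 then -24 else 0) else (if g ^ 5 = 1 then 0 else -12)

/-- `M₁ = #fix` as a complex function. [cite: JamesLiebeck2001, Example 19.16] -/
def M1 : Perm5 → ℂ := fun g => ((fixN g : ℕ) : ℂ)

/-- `sgn` as a complex function. [cite: JamesLiebeck2001, Example 19.16] -/
def sgnR : Perm5 → ℂ := fun g => ((sgnZ g : ℤ) : ℂ)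

/-- `M₁' = sgn · #fix`. [cite: JamesLiebeck2001, Example 19.16] -/
def M1s : Perm5 → ℂ := fun g => ((sgnZ g : ℤ) : ℂ) * ((fixN g : ℕ) : ℂ)

/-- `M₂ = Ind_{H₂} 1 = TN2 / 12`. [cite: JamesLiebeck2001, Example 19.16] -/
def M2 : Perm5 → ℂ := fun g => ((TN2 g : ℕ) : ℂ) / 12

/-- `M₂' = sgn · M₂`. [cite: JamesLiebeck2001, Example 19.16] -/
def M2s : Perm5 → ℂ := fun g => ((sgnZ g : ℤ) : ℂ) * (((TN2 g : ℕ) : ℂ) / 12)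

/-- `M₃ = Ind_{H₂} τ = TN3 / 12`. [cite: JamesLiebeck2001, Example 19.16] -/
def M3 : Perm5 → ℂ := fun g => ((TN3 g : ℤ) : ℂ) / 12

/-- `M₃' = sgn · M₃`. [cite: JamesLiebeck2001, Example 19.16] -/
def M3s : Perm5 → ℂ := fun g => ((sgnZ g : ℤ) : ℂ) * (((TN3 g : ℤ) : ℂ) / 12)

/-- `ψ₄ = #fix − 1` (J–L `χ₃`). [cite: JamesLiebeck2001, Example 19.16] -/
def chi41 : Perm5 → ℂ := fun g => ((fixN g : ℕ) : ℂ) - 1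

/-- `ψ₄' = sgn · ψ₄` (J–L `χ₄`). [cite: JamesLiebeck2001, Example 19.16] -/
def chi2111 : Perm5 → ℂ := fun g => ((sgnZ g : ℤ) : ℂ) * (((fixN g : ℕ) : ℂ) - 1)

/-- `ψ₅ = M₂ − #fix = χ_S − χ₁ − χ₃` (J–L `χ₆`). [cite: JamesLiebeck2001, Example 19.16] -/
def chi32 : Perm5 → ℂ := fun g => ((TN2 g : ℕ) : ℂ) / 12 - ((fixN g : ℕ) : ℂ)

/-- `ψ₅' = sgn · ψ₅` (J–L `χ₇`). [cite: JamesLiebeck2001, Example 19.16] -/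
def chi221 : Perm5 → ℂ := fun g => ((sgnZ g : ℤ) : ℂ) * (((TN2 g : ℕ) : ℂ) / 12 - ((fixN g : ℕ) : ℂ))

/-- `ψ₆ = M₃ − ψ₄ = χ_A` (J–L `χ₅`). [cite: JamesLiebeck2001, Example 19.16] -/
def chi311 : Perm5 → ℂ := fun g => ((TN3 g : ℤ) : ℂ) / 12 - ((fixN g : ℕ) : ℂ) + 1

/-! #### Kernel computations -/

/-- `1 ∈ H₂`. [folklore] -/
private theorem inH2_one : inH2 1 = true := by decide

/-- `H₂` is closed under multiplication. [folklore] -/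
private theorem inH2_mul :
    ∀ a : Perm5, inH2 a = true → ∀ b : Perm5, inH2 b = true → inH2 (a * b) = true := by
  decide +kernel

/-- `H₂` is closed under inversion. [folklore] -/
private theorem inH2_inv : ∀ a : Perm5, inH2 a = true → inH2 a⁻¹ = true := by decide +kernel

/-- `|H₂| = 12`. [folklore] -/
private theorem card_filter_inH2 : (Finset.univ.filter fun g : Perm5 => inH2 g = true).card = 12 := by
  decide +kernel

/-- `τ(1) = 1`. [folklore] -/
private theorem swapU_one : swapU 1 = 1 := by decide

/-- `τ` is multiplicative on `H₂`. [folklore] -/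
private theorem swapU_mul : ∀ a : Perm5, inH2 a = true → ∀ b : Perm5, inH2 b = true →
    swapU (a * b) = swapU a * swapU b := by
  decide +kernel

/-- **The table of `Ind_{H₂} 1`** (times `|H₂| = 12`). [cite: JamesLiebeck2001, Example 19.16] -/
theorem S2_eq_TN2 : ∀ g : Perm5, S2 g = TN2 g := by decide +kernel

/-- **The table of `Ind_{H₂} τ`** (times `|H₂| = 12`). [cite: JamesLiebeck2001, Example 19.16] -/
theorem S3_eq_TN3 : ∀ g : Perm5, S3 g = TN3 g := by decide +kernel

/-- `|S₅| = 120`. [folklore] -/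
private theorem card_G : Fintype.card Perm5 = 120 := by
  rw [Fintype.card_perm, Fintype.card_fin]; rfl

/-- The class-function identity `Ind_1^{S₅} 1 = −4(M₁ + M₁') + 5(M₂ + M₂') + 3(M₃ + M₃')`
(times `12`), pointwise. [cite: JamesLiebeck2001, Example 19.16] -/
private theorem reg_identity : ∀ g : Perm5,
    (if g = 1 then (1440 : ℤ) else 0) =
      -48 * ((fixN g : ℤ) + sgnZ g * (fixN g : ℤ)) + 5 * ((TN2 g : ℤ) + sgnZ g * (TN2 g : ℤ)) +
        3 * (TN3 g + sgnZ g * TN3 g) := by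
  decide +kernel

/-- The class-function identity `M₃ − M₃' = M₁ − M₁' − 1 + sgn` (times `12`), pointwise.
[cite: JamesLiebeck2001, Example 19.16] -/
private theorem diff_identity : ∀ g : Perm5,
    TN3 g - sgnZ g * TN3 g = 12 * (fixN g : ℤ) - 12 * (sgnZ g * (fixN g : ℤ)) - 12 + 12 * sgnZ g := by
  decide +kernel

/-- A scalar product of rational-valued functions on `S₅`, reduced to an integer sum. [folklore] -/
private theorem classInner_eq_of_sum (φ ψ : Perm5 → ℂ) (F : Perm5 → ℤ) (k : ℤ)
    (hF : ∀ g, φ g * ψ g⁻¹ * 144 = (F g : ℂ)) (hsum : ∑ g : Perm5, F g = 120 * k) :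
    classInner φ ψ = (k : ℂ) / 144 := by
  rw [classInner_apply, card_G]
  have h : ∑ g : Perm5, φ g * ψ g⁻¹ = ((∑ g : Perm5, F g : ℤ) : ℂ) / 144 := by
    rw [Int.cast_sum, Finset.sum_div]
    refine Finset.sum_congr rfl fun g _ => ?_
    rw [← hF g]; ring
  rw [h, hsum]
  push_cast
  ring

/-- `Σ_g (12·M₂)(g) · (12·1)(g⁻¹) = 120 · 144` (`⟨M₂, 1⟩ = 1`).
[cite: JamesLiebeck2001, Example 19.16] -/
private theorem sum_M2_one :
    ∑ g : Perm5, ((TN2 g : ℤ)) * ((12 : ℤ)) = 120 * 144 := by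
  decide +kernel

/-- `⟨M₂, 1⟩ = 1`. [cite: JamesLiebeck2001, Example 19.16] -/
private theorem classInner_M2_one : classInner M2 1 = 1 := by
  rw [classInner_eq_of_sum _ _ (fun g => ((TN2 g : ℤ)) * ((12 : ℤ))) 144
    (fun g => by simp only [M2, Pi.one_apply]; push_cast; ring) sum_M2_one]
  norm_num

/-- `Σ_g (12·M₂ − 1)(g) · (12·ψ₄)(g⁻¹) = 120 · 144` (`⟨M₂ − 1, ψ₄⟩ = 1`).
[cite: JamesLiebeck2001, Example 19.16] -/
private theorem sum_M2subOne_chi41 :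
    ∑ g : Perm5, (((TN2 g : ℤ) - 12)) * (12 * ((fixN g⁻¹ : ℤ) - 1)) = 120 * 144 := by
  decide +kernel

/-- `⟨M₂ − 1, ψ₄⟩ = 1`. [cite: JamesLiebeck2001, Example 19.16] -/
private theorem classInner_M2subOne_chi41 : classInner (M2 - 1) chi41 = 1 := by
  rw [classInner_eq_of_sum _ _ (fun g => (((TN2 g : ℤ) - 12)) * (12 * ((fixN g⁻¹ : ℤ) - 1))) 144
    (fun g => by simp only [Pi.sub_apply, Pi.one_apply, M2, chi41]; push_cast; ring) sum_M2subOne_chi41]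
  norm_num

/-- `Σ_g (12·ψ₅)(g) · (12·ψ₅)(g⁻¹) = 120 · 144` (`⟨ψ₅, ψ₅⟩ = 1`).
[cite: JamesLiebeck2001, Example 19.16] -/
private theorem sum_chi32_chi32 :
    ∑ g : Perm5, (((TN2 g : ℤ) - 12 * (fixN g : ℤ))) * (((TN2 g⁻¹ : ℤ) - 12 * (fixN g⁻¹ : ℤ))) = 120 * 144 := by
  decide +kernel

/-- `⟨ψ₅, ψ₅⟩ = 1`. [cite: JamesLiebeck2001, Example 19.16] -/
private theorem classInner_chi32_chi32 : classInner chi32 chi32 = 1 := by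
  rw [classInner_eq_of_sum _ _ (fun g => (((TN2 g : ℤ) - 12 * (fixN g : ℤ))) * (((TN2 g⁻¹ : ℤ) - 12 * (fixN g⁻¹ : ℤ)))) 144
    (fun g => by simp only [chi32]; push_cast; ring) sum_chi32_chi32]
  norm_num

/-- `Σ_g (12·M₃)(g) · (12·ψ₄)(g⁻¹) = 120 · 144` (`⟨M₃, ψ₄⟩ = 1`).
[cite: JamesLiebeck2001, Example 19.16] -/
private theorem sum_M3_chi41 :
    ∑ g : Perm5, (TN3 g) * (12 * ((fixN g⁻¹ : ℤ) - 1)) = 120 * 144 := by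
  decide +kernel

/-- `⟨M₃, ψ₄⟩ = 1`. [cite: JamesLiebeck2001, Example 19.16] -/
private theorem classInner_M3_chi41 : classInner M3 chi41 = 1 := by
  rw [classInner_eq_of_sum _ _ (fun g => (TN3 g) * (12 * ((fixN g⁻¹ : ℤ) - 1))) 144
    (fun g => by simp only [M3, chi41]; push_cast; ring) sum_M3_chi41]
  norm_num

/-- `Σ_g (12·ψ₆)(g) · (12·ψ₆)(g⁻¹) = 120 · 144` (`⟨ψ₆, ψ₆⟩ = 1`).
[cite: JamesLiebeck2001, Example 19.16] -/
private theorem sum_chi311_chi311 :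
    ∑ g : Perm5, ((TN3 g - 12 * (fixN g : ℤ) + 12)) * ((TN3 g⁻¹ - 12 * (fixN g⁻¹ : ℤ) + 12)) = 120 * 144 := by
  decide +kernel

/-- `⟨ψ₆, ψ₆⟩ = 1`. [cite: JamesLiebeck2001, Example 19.16] -/
private theorem classInner_chi311_chi311 : classInner chi311 chi311 = 1 := by
  rw [classInner_eq_of_sum _ _ (fun g => ((TN3 g - 12 * (fixN g : ℤ) + 12)) * ((TN3 g⁻¹ - 12 * (fixN g⁻¹ : ℤ) + 12))) 144
    (fun g => by simp only [chi311]; push_cast; ring) sum_chi311_chi311]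
  norm_num

/-- `Σ_g (12·ψ₄)(g) · (12·M₁)(g⁻¹) = 120 · 144` (`⟨ψ₄, M₁⟩ = 1`).
[cite: JamesLiebeck2001, Example 19.16] -/
private theorem sum_chi41_M1 :
    ∑ g : Perm5, (12 * ((fixN g : ℤ) - 1)) * (12 * (fixN g⁻¹ : ℤ)) = 120 * 144 := by
  decide +kernel

/-- `⟨ψ₄, M₁⟩ = 1`. [cite: JamesLiebeck2001, Example 19.16] -/
private theorem classInner_chi41_M1 : classInner chi41 M1 = 1 := by
  rw [classInner_eq_of_sum _ _ (fun g => (12 * ((fixN g : ℤ) - 1)) * (12 * (fixN g⁻¹ : ℤ))) 144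
    (fun g => by simp only [chi41, M1]; push_cast; ring) sum_chi41_M1]
  norm_num

/-- `Σ_g (12·ψ₄)(g) · (12·M₁')(g⁻¹) = 120 · 0` (`⟨ψ₄, M₁'⟩ = 0`).
[cite: JamesLiebeck2001, Example 19.16] -/
private theorem sum_chi41_M1s :
    ∑ g : Perm5, (12 * ((fixN g : ℤ) - 1)) * (12 * (sgnZ g⁻¹ * (fixN g⁻¹ : ℤ))) = 120 * 0 := by
  decide +kernel

/-- `⟨ψ₄, M₁'⟩ = 0`. [cite: JamesLiebeck2001, Example 19.16] -/
private theorem classInner_chi41_M1s : classInner chi41 M1s = 0 := by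
  rw [classInner_eq_of_sum _ _ (fun g => (12 * ((fixN g : ℤ) - 1)) * (12 * (sgnZ g⁻¹ * (fixN g⁻¹ : ℤ)))) 0
    (fun g => by simp only [chi41, M1s]; push_cast; ring) sum_chi41_M1s]
  norm_num

/-- `Σ_g (12·ψ₄)(g) · (12·M₂)(g⁻¹) = 120 · 144` (`⟨ψ₄, M₂⟩ = 1`).
[cite: JamesLiebeck2001, Example 19.16] -/
private theorem sum_chi41_M2 :
    ∑ g : Perm5, (12 * ((fixN g : ℤ) - 1)) * ((TN2 g⁻¹ : ℤ)) = 120 * 144 := by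
  decide +kernel

/-- `⟨ψ₄, M₂⟩ = 1`. [cite: JamesLiebeck2001, Example 19.16] -/
private theorem classInner_chi41_M2 : classInner chi41 M2 = 1 := by
  rw [classInner_eq_of_sum _ _ (fun g => (12 * ((fixN g : ℤ) - 1)) * ((TN2 g⁻¹ : ℤ))) 144
    (fun g => by simp only [chi41, M2]; push_cast; ring) sum_chi41_M2]
  norm_num

/-- `Σ_g (12·ψ₄)(g) · (12·M₂')(g⁻¹) = 120 · 0` (`⟨ψ₄, M₂'⟩ = 0`).
[cite: JamesLiebeck2001, Example 19.16] -/
private theorem sum_chi41_M2s :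
    ∑ g : Perm5, (12 * ((fixN g : ℤ) - 1)) * (sgnZ g⁻¹ * (TN2 g⁻¹ : ℤ)) = 120 * 0 := by
  decide +kernel

/-- `⟨ψ₄, M₂'⟩ = 0`. [cite: JamesLiebeck2001, Example 19.16] -/
private theorem classInner_chi41_M2s : classInner chi41 M2s = 0 := by
  rw [classInner_eq_of_sum _ _ (fun g => (12 * ((fixN g : ℤ) - 1)) * (sgnZ g⁻¹ * (TN2 g⁻¹ : ℤ))) 0
    (fun g => by simp only [chi41, M2s]; push_cast; ring) sum_chi41_M2s]
  norm_num

/-- `Σ_g (12·ψ₄)(g) · (12·M₃)(g⁻¹) = 120 · 144` (`⟨ψ₄, M₃⟩ = 1`).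
[cite: JamesLiebeck2001, Example 19.16] -/
private theorem sum_chi41_M3 :
    ∑ g : Perm5, (12 * ((fixN g : ℤ) - 1)) * (TN3 g⁻¹) = 120 * 144 := by
  decide +kernel

/-- `⟨ψ₄, M₃⟩ = 1`. [cite: JamesLiebeck2001, Example 19.16] -/
private theorem classInner_chi41_M3 : classInner chi41 M3 = 1 := by
  rw [classInner_eq_of_sum _ _ (fun g => (12 * ((fixN g : ℤ) - 1)) * (TN3 g⁻¹)) 144
    (fun g => by simp only [chi41, M3]; push_cast; ring) sum_chi41_M3]
  norm_num

/-- `Σ_g (12·ψ₄)(g) · (12·M₃')(g⁻¹) = 120 · 0` (`⟨ψ₄, M₃'⟩ = 0`).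
[cite: JamesLiebeck2001, Example 19.16] -/
private theorem sum_chi41_M3s :
    ∑ g : Perm5, (12 * ((fixN g : ℤ) - 1)) * (sgnZ g⁻¹ * TN3 g⁻¹) = 120 * 0 := by
  decide +kernel

/-- `⟨ψ₄, M₃'⟩ = 0`. [cite: JamesLiebeck2001, Example 19.16] -/
private theorem classInner_chi41_M3s : classInner chi41 M3s = 0 := by
  rw [classInner_eq_of_sum _ _ (fun g => (12 * ((fixN g : ℤ) - 1)) * (sgnZ g⁻¹ * TN3 g⁻¹)) 0
    (fun g => by simp only [chi41, M3s]; push_cast; ring) sum_chi41_M3s]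
  norm_num

/-- `Σ_g (12·ψ₄')(g) · (12·M₁)(g⁻¹) = 120 · 0` (`⟨ψ₄', M₁⟩ = 0`).
[cite: JamesLiebeck2001, Example 19.16] -/
private theorem sum_chi2111_M1 :
    ∑ g : Perm5, (12 * (sgnZ g * ((fixN g : ℤ) - 1))) * (12 * (fixN g⁻¹ : ℤ)) = 120 * 0 := by
  decide +kernel

/-- `⟨ψ₄', M₁⟩ = 0`. [cite: JamesLiebeck2001, Example 19.16] -/
private theorem classInner_chi2111_M1 : classInner chi2111 M1 = 0 := by
  rw [classInner_eq_of_sum _ _ (fun g => (12 * (sgnZ g * ((fixN g : ℤ) - 1))) * (12 * (fixN g⁻¹ : ℤ))) 0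
    (fun g => by simp only [chi2111, M1]; push_cast; ring) sum_chi2111_M1]
  norm_num

/-- `Σ_g (12·ψ₄')(g) · (12·M₁')(g⁻¹) = 120 · 144` (`⟨ψ₄', M₁'⟩ = 1`).
[cite: JamesLiebeck2001, Example 19.16] -/
private theorem sum_chi2111_M1s :
    ∑ g : Perm5, (12 * (sgnZ g * ((fixN g : ℤ) - 1))) * (12 * (sgnZ g⁻¹ * (fixN g⁻¹ : ℤ))) = 120 * 144 := by
  decide +kernel

/-- `⟨ψ₄', M₁'⟩ = 1`. [cite: JamesLiebeck2001, Example 19.16] -/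
private theorem classInner_chi2111_M1s : classInner chi2111 M1s = 1 := by
  rw [classInner_eq_of_sum _ _ (fun g => (12 * (sgnZ g * ((fixN g : ℤ) - 1))) * (12 * (sgnZ g⁻¹ * (fixN g⁻¹ : ℤ)))) 144
    (fun g => by simp only [chi2111, M1s]; push_cast; ring) sum_chi2111_M1s]
  norm_num

/-- `Σ_g (12·ψ₄')(g) · (12·M₂)(g⁻¹) = 120 · 0` (`⟨ψ₄', M₂⟩ = 0`).
[cite: JamesLiebeck2001, Example 19.16] -/
private theorem sum_chi2111_M2 :
    ∑ g : Perm5, (12 * (sgnZ g * ((fixN g : ℤ) - 1))) * ((TN2 g⁻¹ : ℤ)) = 120 * 0 := by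
  decide +kernel

/-- `⟨ψ₄', M₂⟩ = 0`. [cite: JamesLiebeck2001, Example 19.16] -/
private theorem classInner_chi2111_M2 : classInner chi2111 M2 = 0 := by
  rw [classInner_eq_of_sum _ _ (fun g => (12 * (sgnZ g * ((fixN g : ℤ) - 1))) * ((TN2 g⁻¹ : ℤ))) 0
    (fun g => by simp only [chi2111, M2]; push_cast; ring) sum_chi2111_M2]
  norm_num

/-- `Σ_g (12·ψ₄')(g) · (12·M₂')(g⁻¹) = 120 · 144` (`⟨ψ₄', M₂'⟩ = 1`).
[cite: JamesLiebeck2001, Example 19.16] -/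
private theorem sum_chi2111_M2s :
    ∑ g : Perm5, (12 * (sgnZ g * ((fixN g : ℤ) - 1))) * (sgnZ g⁻¹ * (TN2 g⁻¹ : ℤ)) = 120 * 144 := by
  decide +kernel

/-- `⟨ψ₄', M₂'⟩ = 1`. [cite: JamesLiebeck2001, Example 19.16] -/
private theorem classInner_chi2111_M2s : classInner chi2111 M2s = 1 := by
  rw [classInner_eq_of_sum _ _ (fun g => (12 * (sgnZ g * ((fixN g : ℤ) - 1))) * (sgnZ g⁻¹ * (TN2 g⁻¹ : ℤ))) 144
    (fun g => by simp only [chi2111, M2s]; push_cast; ring) sum_chi2111_M2s]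
  norm_num

/-- `Σ_g (12·ψ₄')(g) · (12·M₃)(g⁻¹) = 120 · 0` (`⟨ψ₄', M₃⟩ = 0`).
[cite: JamesLiebeck2001, Example 19.16] -/
private theorem sum_chi2111_M3 :
    ∑ g : Perm5, (12 * (sgnZ g * ((fixN g : ℤ) - 1))) * (TN3 g⁻¹) = 120 * 0 := by
  decide +kernel

/-- `⟨ψ₄', M₃⟩ = 0`. [cite: JamesLiebeck2001, Example 19.16] -/
private theorem classInner_chi2111_M3 : classInner chi2111 M3 = 0 := by
  rw [classInner_eq_of_sum _ _ (fun g => (12 * (sgnZ g * ((fixN g : ℤ) - 1))) * (TN3 g⁻¹)) 0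
    (fun g => by simp only [chi2111, M3]; push_cast; ring) sum_chi2111_M3]
  norm_num

/-- `Σ_g (12·ψ₄')(g) · (12·M₃')(g⁻¹) = 120 · 144` (`⟨ψ₄', M₃'⟩ = 1`).
[cite: JamesLiebeck2001, Example 19.16] -/
private theorem sum_chi2111_M3s :
    ∑ g : Perm5, (12 * (sgnZ g * ((fixN g : ℤ) - 1))) * (sgnZ g⁻¹ * TN3 g⁻¹) = 120 * 144 := by
  decide +kernel

/-- `⟨ψ₄', M₃'⟩ = 1`. [cite: JamesLiebeck2001, Example 19.16] -/
private theorem classInner_chi2111_M3s : classInner chi2111 M3s = 1 := by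
  rw [classInner_eq_of_sum _ _ (fun g => (12 * (sgnZ g * ((fixN g : ℤ) - 1))) * (sgnZ g⁻¹ * TN3 g⁻¹)) 144
    (fun g => by simp only [chi2111, M3s]; push_cast; ring) sum_chi2111_M3s]
  norm_num

/-- `Σ_g (12·ψ₅)(g) · (12·M₁)(g⁻¹) = 120 · 0` (`⟨ψ₅, M₁⟩ = 0`).
[cite: JamesLiebeck2001, Example 19.16] -/
private theorem sum_chi32_M1 :
    ∑ g : Perm5, (((TN2 g : ℤ) - 12 * (fixN g : ℤ))) * (12 * (fixN g⁻¹ : ℤ)) = 120 * 0 := by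
  decide +kernel

/-- `⟨ψ₅, M₁⟩ = 0`. [cite: JamesLiebeck2001, Example 19.16] -/
private theorem classInner_chi32_M1 : classInner chi32 M1 = 0 := by
  rw [classInner_eq_of_sum _ _ (fun g => (((TN2 g : ℤ) - 12 * (fixN g : ℤ))) * (12 * (fixN g⁻¹ : ℤ))) 0
    (fun g => by simp only [chi32, M1]; push_cast; ring) sum_chi32_M1]
  norm_num

/-- `Σ_g (12·ψ₅)(g) · (12·M₁')(g⁻¹) = 120 · 0` (`⟨ψ₅, M₁'⟩ = 0`).
[cite: JamesLiebeck2001, Example 19.16] -/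
private theorem sum_chi32_M1s :
    ∑ g : Perm5, (((TN2 g : ℤ) - 12 * (fixN g : ℤ))) * (12 * (sgnZ g⁻¹ * (fixN g⁻¹ : ℤ))) = 120 * 0 := by
  decide +kernel

/-- `⟨ψ₅, M₁'⟩ = 0`. [cite: JamesLiebeck2001, Example 19.16] -/
private theorem classInner_chi32_M1s : classInner chi32 M1s = 0 := by
  rw [classInner_eq_of_sum _ _ (fun g => (((TN2 g : ℤ) - 12 * (fixN g : ℤ))) * (12 * (sgnZ g⁻¹ * (fixN g⁻¹ : ℤ)))) 0
    (fun g => by simp only [chi32, M1s]; push_cast; ring) sum_chi32_M1s]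
  norm_num

/-- `Σ_g (12·ψ₅)(g) · (12·M₂)(g⁻¹) = 120 · 144` (`⟨ψ₅, M₂⟩ = 1`).
[cite: JamesLiebeck2001, Example 19.16] -/
private theorem sum_chi32_M2 :
    ∑ g : Perm5, (((TN2 g : ℤ) - 12 * (fixN g : ℤ))) * ((TN2 g⁻¹ : ℤ)) = 120 * 144 := by
  decide +kernel

/-- `⟨ψ₅, M₂⟩ = 1`. [cite: JamesLiebeck2001, Example 19.16] -/
private theorem classInner_chi32_M2 : classInner chi32 M2 = 1 := by
  rw [classInner_eq_of_sum _ _ (fun g => (((TN2 g : ℤ) - 12 * (fixN g : ℤ))) * ((TN2 g⁻¹ : ℤ))) 144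
    (fun g => by simp only [chi32, M2]; push_cast; ring) sum_chi32_M2]
  norm_num

/-- `Σ_g (12·ψ₅)(g) · (12·M₂')(g⁻¹) = 120 · 0` (`⟨ψ₅, M₂'⟩ = 0`).
[cite: JamesLiebeck2001, Example 19.16] -/
private theorem sum_chi32_M2s :
    ∑ g : Perm5, (((TN2 g : ℤ) - 12 * (fixN g : ℤ))) * (sgnZ g⁻¹ * (TN2 g⁻¹ : ℤ)) = 120 * 0 := by
  decide +kernel

/-- `⟨ψ₅, M₂'⟩ = 0`. [cite: JamesLiebeck2001, Example 19.16] -/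
private theorem classInner_chi32_M2s : classInner chi32 M2s = 0 := by
  rw [classInner_eq_of_sum _ _ (fun g => (((TN2 g : ℤ) - 12 * (fixN g : ℤ))) * (sgnZ g⁻¹ * (TN2 g⁻¹ : ℤ))) 0
    (fun g => by simp only [chi32, M2s]; push_cast; ring) sum_chi32_M2s]
  norm_num

/-- `Σ_g (12·ψ₅)(g) · (12·M₃)(g⁻¹) = 120 · 0` (`⟨ψ₅, M₃⟩ = 0`).
[cite: JamesLiebeck2001, Example 19.16] -/
private theorem sum_chi32_M3 :
    ∑ g : Perm5, (((TN2 g : ℤ) - 12 * (fixN g : ℤ))) * (TN3 g⁻¹) = 120 * 0 := by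
  decide +kernel

/-- `⟨ψ₅, M₃⟩ = 0`. [cite: JamesLiebeck2001, Example 19.16] -/
private theorem classInner_chi32_M3 : classInner chi32 M3 = 0 := by
  rw [classInner_eq_of_sum _ _ (fun g => (((TN2 g : ℤ) - 12 * (fixN g : ℤ))) * (TN3 g⁻¹)) 0
    (fun g => by simp only [chi32, M3]; push_cast; ring) sum_chi32_M3]
  norm_num

/-- `Σ_g (12·ψ₅)(g) · (12·M₃')(g⁻¹) = 120 · 0` (`⟨ψ₅, M₃'⟩ = 0`).
[cite: JamesLiebeck2001, Example 19.16] -/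
private theorem sum_chi32_M3s :
    ∑ g : Perm5, (((TN2 g : ℤ) - 12 * (fixN g : ℤ))) * (sgnZ g⁻¹ * TN3 g⁻¹) = 120 * 0 := by
  decide +kernel

/-- `⟨ψ₅, M₃'⟩ = 0`. [cite: JamesLiebeck2001, Example 19.16] -/
private theorem classInner_chi32_M3s : classInner chi32 M3s = 0 := by
  rw [classInner_eq_of_sum _ _ (fun g => (((TN2 g : ℤ) - 12 * (fixN g : ℤ))) * (sgnZ g⁻¹ * TN3 g⁻¹)) 0
    (fun g => by simp only [chi32, M3s]; push_cast; ring) sum_chi32_M3s]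
  norm_num

/-- `Σ_g (12·ψ₅')(g) · (12·M₁)(g⁻¹) = 120 · 0` (`⟨ψ₅', M₁⟩ = 0`).
[cite: JamesLiebeck2001, Example 19.16] -/
private theorem sum_chi221_M1 :
    ∑ g : Perm5, (sgnZ g * ((TN2 g : ℤ) - 12 * (fixN g : ℤ))) * (12 * (fixN g⁻¹ : ℤ)) = 120 * 0 := by
  decide +kernel

/-- `⟨ψ₅', M₁⟩ = 0`. [cite: JamesLiebeck2001, Example 19.16] -/
private theorem classInner_chi221_M1 : classInner chi221 M1 = 0 := by
  rw [classInner_eq_of_sum _ _ (fun g => (sgnZ g * ((TN2 g : ℤ) - 12 * (fixN g : ℤ))) * (12 * (fixN g⁻¹ : ℤ))) 0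
    (fun g => by simp only [chi221, M1]; push_cast; ring) sum_chi221_M1]
  norm_num

/-- `Σ_g (12·ψ₅')(g) · (12·M₁')(g⁻¹) = 120 · 0` (`⟨ψ₅', M₁'⟩ = 0`).
[cite: JamesLiebeck2001, Example 19.16] -/
private theorem sum_chi221_M1s :
    ∑ g : Perm5, (sgnZ g * ((TN2 g : ℤ) - 12 * (fixN g : ℤ))) * (12 * (sgnZ g⁻¹ * (fixN g⁻¹ : ℤ))) = 120 * 0 := by
  decide +kernel

/-- `⟨ψ₅', M₁'⟩ = 0`. [cite: JamesLiebeck2001, Example 19.16] -/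
private theorem classInner_chi221_M1s : classInner chi221 M1s = 0 := by
  rw [classInner_eq_of_sum _ _ (fun g => (sgnZ g * ((TN2 g : ℤ) - 12 * (fixN g : ℤ))) * (12 * (sgnZ g⁻¹ * (fixN g⁻¹ : ℤ)))) 0
    (fun g => by simp only [chi221, M1s]; push_cast; ring) sum_chi221_M1s]
  norm_num

/-- `Σ_g (12·ψ₅')(g) · (12·M₂)(g⁻¹) = 120 · 0` (`⟨ψ₅', M₂⟩ = 0`).
[cite: JamesLiebeck2001, Example 19.16] -/
private theorem sum_chi221_M2 :
    ∑ g : Perm5, (sgnZ g * ((TN2 g : ℤ) - 12 * (fixN g : ℤ))) * ((TN2 g⁻¹ : ℤ)) = 120 * 0 := by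
  decide +kernel

/-- `⟨ψ₅', M₂⟩ = 0`. [cite: JamesLiebeck2001, Example 19.16] -/
private theorem classInner_chi221_M2 : classInner chi221 M2 = 0 := by
  rw [classInner_eq_of_sum _ _ (fun g => (sgnZ g * ((TN2 g : ℤ) - 12 * (fixN g : ℤ))) * ((TN2 g⁻¹ : ℤ))) 0
    (fun g => by simp only [chi221, M2]; push_cast; ring) sum_chi221_M2]
  norm_num

/-- `Σ_g (12·ψ₅')(g) · (12·M₂')(g⁻¹) = 120 · 144` (`⟨ψ₅', M₂'⟩ = 1`).
[cite: JamesLiebeck2001, Example 19.16] -/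
private theorem sum_chi221_M2s :
    ∑ g : Perm5, (sgnZ g * ((TN2 g : ℤ) - 12 * (fixN g : ℤ))) * (sgnZ g⁻¹ * (TN2 g⁻¹ : ℤ)) = 120 * 144 := by
  decide +kernel

/-- `⟨ψ₅', M₂'⟩ = 1`. [cite: JamesLiebeck2001, Example 19.16] -/
private theorem classInner_chi221_M2s : classInner chi221 M2s = 1 := by
  rw [classInner_eq_of_sum _ _ (fun g => (sgnZ g * ((TN2 g : ℤ) - 12 * (fixN g : ℤ))) * (sgnZ g⁻¹ * (TN2 g⁻¹ : ℤ))) 144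
    (fun g => by simp only [chi221, M2s]; push_cast; ring) sum_chi221_M2s]
  norm_num

/-- `Σ_g (12·ψ₅')(g) · (12·M₃)(g⁻¹) = 120 · 0` (`⟨ψ₅', M₃⟩ = 0`).
[cite: JamesLiebeck2001, Example 19.16] -/
private theorem sum_chi221_M3 :
    ∑ g : Perm5, (sgnZ g * ((TN2 g : ℤ) - 12 * (fixN g : ℤ))) * (TN3 g⁻¹) = 120 * 0 := by
  decide +kernel

/-- `⟨ψ₅', M₃⟩ = 0`. [cite: JamesLiebeck2001, Example 19.16] -/
private theorem classInner_chi221_M3 : classInner chi221 M3 = 0 := by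
  rw [classInner_eq_of_sum _ _ (fun g => (sgnZ g * ((TN2 g : ℤ) - 12 * (fixN g : ℤ))) * (TN3 g⁻¹)) 0
    (fun g => by simp only [chi221, M3]; push_cast; ring) sum_chi221_M3]
  norm_num

/-- `Σ_g (12·ψ₅')(g) · (12·M₃')(g⁻¹) = 120 · 0` (`⟨ψ₅', M₃'⟩ = 0`).
[cite: JamesLiebeck2001, Example 19.16] -/
private theorem sum_chi221_M3s :
    ∑ g : Perm5, (sgnZ g * ((TN2 g : ℤ) - 12 * (fixN g : ℤ))) * (sgnZ g⁻¹ * TN3 g⁻¹) = 120 * 0 := by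
  decide +kernel

/-- `⟨ψ₅', M₃'⟩ = 0`. [cite: JamesLiebeck2001, Example 19.16] -/
private theorem classInner_chi221_M3s : classInner chi221 M3s = 0 := by
  rw [classInner_eq_of_sum _ _ (fun g => (sgnZ g * ((TN2 g : ℤ) - 12 * (fixN g : ℤ))) * (sgnZ g⁻¹ * TN3 g⁻¹)) 0
    (fun g => by simp only [chi221, M3s]; push_cast; ring) sum_chi221_M3s]
  norm_num

/-- `Σ_g (12·ψ₆)(g) · (12·M₁)(g⁻¹) = 120 · 0` (`⟨ψ₆, M₁⟩ = 0`).
[cite: JamesLiebeck2001, Example 19.16] -/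
private theorem sum_chi311_M1 :
    ∑ g : Perm5, ((TN3 g - 12 * (fixN g : ℤ) + 12)) * (12 * (fixN g⁻¹ : ℤ)) = 120 * 0 := by
  decide +kernel

/-- `⟨ψ₆, M₁⟩ = 0`. [cite: JamesLiebeck2001, Example 19.16] -/
private theorem classInner_chi311_M1 : classInner chi311 M1 = 0 := by
  rw [classInner_eq_of_sum _ _ (fun g => ((TN3 g - 12 * (fixN g : ℤ) + 12)) * (12 * (fixN g⁻¹ : ℤ))) 0
    (fun g => by simp only [chi311, M1]; push_cast; ring) sum_chi311_M1]
  norm_num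

/-- `Σ_g (12·ψ₆)(g) · (12·M₁')(g⁻¹) = 120 · 0` (`⟨ψ₆, M₁'⟩ = 0`).
[cite: JamesLiebeck2001, Example 19.16] -/
private theorem sum_chi311_M1s :
    ∑ g : Perm5, ((TN3 g - 12 * (fixN g : ℤ) + 12)) * (12 * (sgnZ g⁻¹ * (fixN g⁻¹ : ℤ))) = 120 * 0 := by
  decide +kernel

/-- `⟨ψ₆, M₁'⟩ = 0`. [cite: JamesLiebeck2001, Example 19.16] -/
private theorem classInner_chi311_M1s : classInner chi311 M1s = 0 := by
  rw [classInner_eq_of_sum _ _ (fun g => ((TN3 g - 12 * (fixN g : ℤ) + 12)) * (12 * (sgnZ g⁻¹ * (fixN g⁻¹ : ℤ)))) 0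
    (fun g => by simp only [chi311, M1s]; push_cast; ring) sum_chi311_M1s]
  norm_num

/-- `Σ_g (12·ψ₆)(g) · (12·M₂)(g⁻¹) = 120 · 0` (`⟨ψ₆, M₂⟩ = 0`).
[cite: JamesLiebeck2001, Example 19.16] -/
private theorem sum_chi311_M2 :
    ∑ g : Perm5, ((TN3 g - 12 * (fixN g : ℤ) + 12)) * ((TN2 g⁻¹ : ℤ)) = 120 * 0 := by
  decide +kernel

/-- `⟨ψ₆, M₂⟩ = 0`. [cite: JamesLiebeck2001, Example 19.16] -/
private theorem classInner_chi311_M2 : classInner chi311 M2 = 0 := by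
  rw [classInner_eq_of_sum _ _ (fun g => ((TN3 g - 12 * (fixN g : ℤ) + 12)) * ((TN2 g⁻¹ : ℤ))) 0
    (fun g => by simp only [chi311, M2]; push_cast; ring) sum_chi311_M2]
  norm_num

/-- `Σ_g (12·ψ₆)(g) · (12·M₂')(g⁻¹) = 120 · 0` (`⟨ψ₆, M₂'⟩ = 0`).
[cite: JamesLiebeck2001, Example 19.16] -/
private theorem sum_chi311_M2s :
    ∑ g : Perm5, ((TN3 g - 12 * (fixN g : ℤ) + 12)) * (sgnZ g⁻¹ * (TN2 g⁻¹ : ℤ)) = 120 * 0 := by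
  decide +kernel

/-- `⟨ψ₆, M₂'⟩ = 0`. [cite: JamesLiebeck2001, Example 19.16] -/
private theorem classInner_chi311_M2s : classInner chi311 M2s = 0 := by
  rw [classInner_eq_of_sum _ _ (fun g => ((TN3 g - 12 * (fixN g : ℤ) + 12)) * (sgnZ g⁻¹ * (TN2 g⁻¹ : ℤ))) 0
    (fun g => by simp only [chi311, M2s]; push_cast; ring) sum_chi311_M2s]
  norm_num

/-- `Σ_g (12·ψ₆)(g) · (12·M₃)(g⁻¹) = 120 · 144` (`⟨ψ₆, M₃⟩ = 1`).
[cite: JamesLiebeck2001, Example 19.16] -/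
private theorem sum_chi311_M3 :
    ∑ g : Perm5, ((TN3 g - 12 * (fixN g : ℤ) + 12)) * (TN3 g⁻¹) = 120 * 144 := by
  decide +kernel

/-- `⟨ψ₆, M₃⟩ = 1`. [cite: JamesLiebeck2001, Example 19.16] -/
private theorem classInner_chi311_M3 : classInner chi311 M3 = 1 := by
  rw [classInner_eq_of_sum _ _ (fun g => ((TN3 g - 12 * (fixN g : ℤ) + 12)) * (TN3 g⁻¹)) 144
    (fun g => by simp only [chi311, M3]; push_cast; ring) sum_chi311_M3]
  norm_num

/-- `Σ_g (12·ψ₆)(g) · (12·M₃')(g⁻¹) = 120 · 144` (`⟨ψ₆, M₃'⟩ = 1`).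
[cite: JamesLiebeck2001, Example 19.16] -/
private theorem sum_chi311_M3s :
    ∑ g : Perm5, ((TN3 g - 12 * (fixN g : ℤ) + 12)) * (sgnZ g⁻¹ * TN3 g⁻¹) = 120 * 144 := by
  decide +kernel

/-- `⟨ψ₆, M₃'⟩ = 1`. [cite: JamesLiebeck2001, Example 19.16] -/
private theorem classInner_chi311_M3s : classInner chi311 M3s = 1 := by
  rw [classInner_eq_of_sum _ _ (fun g => ((TN3 g - 12 * (fixN g : ℤ) + 12)) * (sgnZ g⁻¹ * TN3 g⁻¹)) 144
    (fun g => by simp only [chi311, M3s]; push_cast; ring) sum_chi311_M3s]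
  norm_num
/-! #### The subgroups `H₂ ≅ S₃ × S₂`, `G_0 ≅ S₄` and their linear characters -/

/-- `H₂ = Stab({3, 4}) ≅ S₃ × S₂`, of order `12`. [cite: JamesLiebeck2001, Example 19.16] -/
def H2 : Subgroup Perm5 where
  carrier := {g | inH2 g = true}
  mul_mem' := fun {a} {b} ha hb => inH2_mul a ha b hb
  one_mem' := inH2_one
  inv_mem' := fun {a} ha => inH2_inv a ha

/-- `|H₂| = 12`. [folklore] -/
private theorem natCard_H2 : Nat.card H2 = 12 := by
  have h : Nat.card H2 = Nat.card {g : Perm5 // inH2 g = true} := rfl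
  rw [h, Nat.card_eq_fintype_card, Fintype.card_subtype]
  exact card_filter_inH2

/-- The sign `τ` of the `S₂`-component, `H₂ → {±1} ⊂ ℤˣ`. [cite: JamesLiebeck2001, Example 19.16] -/
def swapHom : H2 →* ℤˣ where
  toFun h := swapU h
  map_one' := swapU_one
  map_mul' := fun a b => swapU_mul a a.2 b b.2

/-- `τ` as a homomorphism `H₂ → ℂˣ`. [cite: JamesLiebeck2001, Example 19.16] -/
def theta3 : H2 →* ℂˣ := (Units.map ((Int.castRingHom ℂ).toMonoidHom)).comp swapHom

/-- The sign character `sgn : S₅ → ℂˣ`. [cite: JamesLiebeck2001, Example 19.16] -/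
def sgnC : Perm5 →* ℂˣ := (Units.map ((Int.castRingHom ℂ).toMonoidHom)).comp Equiv.Perm.sign

/-- `sgn` restricted to `H₂`. [cite: JamesLiebeck2001, Example 19.16] -/
def theta2s : H2 →* ℂˣ := sgnC.comp H2.subtype

/-- `τ · sgn` on `H₂`. [cite: JamesLiebeck2001, Example 19.16] -/
def theta3s : H2 →* ℂˣ := theta3 * theta2s

/-- `sgn` restricted to the point stabiliser `G_0 ≅ S₄`. [cite: JamesLiebeck2001, Example 19.16] -/
def theta1s : stabilizer Perm5 (0 : Fin 5) →* ℂˣ := sgnC.comp (stabilizer Perm5 (0 : Fin 5)).subtype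

/-- Values of `sgnC`. [folklore] -/
private theorem coe_sgnC (g : Perm5) : ((sgnC g : ℂˣ) : ℂ) = sgnR g := by
  simp [sgnC, sgnR, sgnZ]

/-- Values of `τ`. [folklore] -/
private theorem coe_theta3 (h : H2) : ((theta3 h : ℂˣ) : ℂ) = (((swapU h : ℤˣ) : ℤ) : ℂ) := by
  simp [theta3, swapHom]

/-- `sgn` is a class function. [folklore] -/
private theorem isClassFun_sgnR : IsClassFun sgnR := by
  have h := (isCharacter_coe_monoidHom' sgnC).isClassFun
  have he : (fun g => ((sgnC g : ℂˣ) : ℂ)) = sgnR := funext coe_sgnC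
  rwa [he] at h

/-- `sgn` is a character with `sgn 1 = 1`. [folklore] -/
private theorem isCharacter_sgnR : IsCharacter Perm5 sgnR := by
  have h := isCharacter_coe_monoidHom' sgnC
  have he : (fun g => ((sgnC g : ℂˣ) : ℂ)) = sgnR := funext coe_sgnC
  rwa [he] at h

/-- `sgn 1 = 1`. [folklore] -/
private theorem sgnR_one : sgnR 1 = 1 := by simp [sgnR, sgnZ]

/-! #### The six monomial characters as explicit functions -/

/-- `Ind_{H₂}^{S₅} θ` by the defining sum, with the Boolean membership test.
[cite: Isaacs1976, Lemma 5.14] -/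
private theorem indClassFun_H2_apply (θ : H2 →* ℂˣ) (f : Perm5 → ℂ)
    (hf : ∀ h : H2, ((θ h : ℂˣ) : ℂ) = f h) (s : Perm5) :
    indClassFun H2 (fun h => ((θ h : ℂˣ) : ℂ)) s =
      (12 : ℂ)⁻¹ * ∑ t : Perm5, if inH2 (t⁻¹ * s * t) = true then f (t⁻¹ * s * t) else 0 := by
  rw [indClassFun_apply, natCard_H2, Nat.cast_ofNat]
  congr 1
  refine Finset.sum_congr rfl fun t _ => ?_
  by_cases h : inH2 (t⁻¹ * s * t) = true
  · have hmem : t⁻¹ * s * t ∈ H2 := h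
    rw [show t⁻¹ * s * t = ((⟨t⁻¹ * s * t, hmem⟩ : H2) : Perm5) from rfl, extend_subtypeVal_apply, hf,
      if_pos h]
  · have hnmem : t⁻¹ * s * t ∉ H2 := h
    rw [extend_subtypeVal_of_not_mem _ _ hnmem, if_neg h]

/-- **`M₂ = Ind_{H₂} 1 = TN2/12`** as a function on `S₅`. [cite: JamesLiebeck2001, Example 19.16] -/
theorem ind_M2 : indClassFun H2 (fun h => ((1 : H2 →* ℂˣ) h : ℂ)) = M2 := by
  funext s
  rw [indClassFun_H2_apply 1 (fun _ => 1) (fun h => by simp) s, Finset.sum_boole]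
  show _ = ((TN2 s : ℕ) : ℂ) / 12
  rw [← S2_eq_TN2 s, div_eq_inv_mul]
  rfl

/-- **`M₃ = Ind_{H₂} τ = TN3/12`** as a function on `S₅`. [cite: JamesLiebeck2001, Example 19.16] -/
theorem ind_M3 : indClassFun H2 (fun h => ((theta3 h : ℂˣ) : ℂ)) = M3 := by
  funext s
  rw [indClassFun_H2_apply theta3 (fun g => (((swapU g : ℤˣ) : ℤ) : ℂ)) coe_theta3 s, M3,
    ← S3_eq_TN3 s, S3, Int.cast_sum, div_eq_inv_mul]
  congr 1
  refine Finset.sum_congr rfl fun t _ => ?_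
  split_ifs <;> simp

/-- **`M₂' = Ind_{H₂} sgn = sgn · M₂`** (projection formula). [cite: SerreLinearRepresentations1977, §7.2 Remark (3)] -/
theorem ind_M2s : indClassFun H2 (fun h => ((theta2s h : ℂˣ) : ℂ)) = M2s := by
  have he : (fun h : H2 => ((theta2s h : ℂˣ) : ℂ)) =
      fun h : H2 => (fun h' : H2 => ((1 : H2 →* ℂˣ) h' : ℂ)) h * sgnR (h : Perm5) := by
    funext h
    simp [theta2s, coe_sgnC]
  rw [he, indClassFun_mul_restrict H2 _ isClassFun_sgnR, ind_M2]
  funext g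
  simp only [Pi.mul_apply, M2, M2s, sgnR]
  ring

/-- **`M₃' = Ind_{H₂} (τ · sgn) = sgn · M₃`** (projection formula).
[cite: SerreLinearRepresentations1977, §7.2 Remark (3)] -/
theorem ind_M3s : indClassFun H2 (fun h => ((theta3s h : ℂˣ) : ℂ)) = M3s := by
  have he : (fun h : H2 => ((theta3s h : ℂˣ) : ℂ)) =
      fun h : H2 => (fun h' : H2 => ((theta3 h' : ℂˣ) : ℂ)) h * sgnR (h : Perm5) := by
    funext h
    rw [theta3s, MonoidHom.mul_apply, Units.val_mul, ← coe_sgnC]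
    rfl
  rw [he, indClassFun_mul_restrict H2 _ isClassFun_sgnR, ind_M3]
  funext g
  simp only [Pi.mul_apply, M3, M3s, sgnR]
  ring

/-- `#fix` as `Nat.card` of Mathlib's `fixedBy`. [folklore] -/
private theorem natCard_fixedBy_eq_fixN (g : Perm5) : Nat.card (fixedBy (Fin 5) g) = fixN g := by
  rw [fixN, ← Fintype.card_subtype]
  exact Nat.card_eq_fintype_card

/-- **`M₁ = Ind_{G_0} 1 = #fix`** (Isaacs 5.14). [cite: Isaacs1976, Lemma 5.14] -/
theorem ind_M1 :
    indClassFun (stabilizer Perm5 (0 : Fin 5))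
      (fun h => ((1 : stabilizer Perm5 (0 : Fin 5) →* ℂˣ) h : ℂ)) = M1 := by
  have h1 : (fun h => ((1 : stabilizer Perm5 (0 : Fin 5) →* ℂˣ) h : ℂ)) =
      (1 : stabilizer Perm5 (0 : Fin 5) → ℂ) := by
    funext h; simp
  rw [h1, indClassFun_stabilizer_one (0 : Fin 5)]
  funext s
  rw [natCard_fixedBy_eq_fixN, M1]

/-- **`M₁' = Ind_{G_0} sgn = sgn · #fix`** (projection formula).
[cite: SerreLinearRepresentations1977, §7.2 Remark (3)] -/
theorem ind_M1s :
    indClassFun (stabilizer Perm5 (0 : Fin 5)) (fun h => ((theta1s h : ℂˣ) : ℂ)) = M1s := by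
  have he : (fun h : stabilizer Perm5 (0 : Fin 5) => ((theta1s h : ℂˣ) : ℂ)) =
      fun h : stabilizer Perm5 (0 : Fin 5) =>
        (fun h' : stabilizer Perm5 (0 : Fin 5) => ((1 : stabilizer Perm5 (0 : Fin 5) →* ℂˣ) h' : ℂ)) h *
          sgnR (h : Perm5) := by
    funext h
    simp [theta1s, coe_sgnC]
  rw [he, indClassFun_mul_restrict _ _ isClassFun_sgnR, ind_M1]
  funext g
  simp only [Pi.mul_apply, M1, M1s, sgnR]
  ring

/-! #### The irreducible characters `ψ₄, ψ₄', ψ₅, ψ₅', ψ₆` -/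

/-- `ψ₄ = #fix − 1` is irreducible (2-transitivity). [cite: JamesLiebeck2001, Ex. 29.11 (1)] -/
theorem isIrrChar_chi41 : IsIrrChar Perm5 chi41 := by
  have h := isIrrChar_perm_natCard_fixedBy_sub_one (Ω := Fin 5)
  have he : (fun σ : Perm5 => (Nat.card (fixedBy (Fin 5) σ) : ℂ) - 1) = chi41 := by
    funext σ; rw [chi41, natCard_fixedBy_eq_fixN]
  rwa [he] at h

/-- `ψ₄' = ψ₄ · sgn` is irreducible. [cite: JamesLiebeck2001, Example 19.16] -/
theorem isIrrChar_chi2111 : IsIrrChar Perm5 chi2111 := by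
  have he : chi2111 = chi41 * sgnR := by
    funext g; simp only [chi2111, chi41, sgnR, Pi.mul_apply]; ring
  rw [he]
  exact (isIrrChar_mul_iff_of_apply_one_eq_one chi41 isCharacter_sgnR sgnR_one).mpr isIrrChar_chi41

/-- `M₂` is a character. [folklore] -/
private theorem isCharacter_M2 : IsCharacter Perm5 M2 := by
  rw [← ind_M2]; exact (isCharacter_coe_monoidHom' (1 : H2 →* ℂˣ)).indClassFun H2

/-- `M₃` is a character. [folklore] -/
private theorem isCharacter_M3 : IsCharacter Perm5 M3 := by
  rw [← ind_M3]; exact (isCharacter_coe_monoidHom' theta3).indClassFun H2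

/-- **`ψ₅ = M₂ − 1 − ψ₄` is an irreducible character of `S₅`** (`⟨M₂, 1⟩ = 1`, `⟨M₂ − 1, ψ₄⟩ = 1`,
`⟨ψ₅, ψ₅⟩ = 1`; James–Liebeck's `χ₆ = χ_S − χ₁ − χ₃`). [cite: JamesLiebeck2001, Example 19.16] -/
theorem isIrrChar_chi32 : IsIrrChar Perm5 chi32 := by
  have h1 := sub_eq_zero_or_isCharacter isCharacter_M2 isIrrChar_one'' classInner_M2_one
  have hM21 : IsCharacter Perm5 (M2 - 1) := by
    rcases h1 with h0 | h
    · exfalso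
      have := classInner_M2subOne_chi41
      rw [h0, classInner_zero_left] at this
      exact zero_ne_one this
    · exact h
  have h2 := sub_eq_zero_or_isCharacter hM21 isIrrChar_chi41 classInner_M2subOne_chi41
  have he : M2 - 1 - chi41 = chi32 := by
    funext g; simp only [Pi.sub_apply, Pi.one_apply, M2, chi41, chi32]; ring
  rw [he] at h2
  exact isIrrChar_of_zero_or_isCharacter h2 classInner_chi32_chi32

/-- `ψ₅' = ψ₅ · sgn` is irreducible (J–L `χ₇ = χ₆χ₂`). [cite: JamesLiebeck2001, Example 19.16] -/
theorem isIrrChar_chi221 : IsIrrChar Perm5 chi221 := by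
  have he : chi221 = chi32 * sgnR := by
    funext g; simp only [chi221, chi32, sgnR, Pi.mul_apply]; ring
  rw [he]
  exact (isIrrChar_mul_iff_of_apply_one_eq_one chi32 isCharacter_sgnR sgnR_one).mpr isIrrChar_chi32

/-- **`ψ₆ = M₃ − ψ₄` is an irreducible character of `S₅`** (`⟨M₃, ψ₄⟩ = 1`, `⟨ψ₆, ψ₆⟩ = 1`;
James–Liebeck's `χ₅ = χ_A`). [cite: JamesLiebeck2001, Example 19.16] -/
theorem isIrrChar_chi311 : IsIrrChar Perm5 chi311 := by
  have h1 := sub_eq_zero_or_isCharacter isCharacter_M3 isIrrChar_chi41 classInner_M3_chi41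
  have he : M3 - chi41 = chi311 := by
    funext g; simp only [Pi.sub_apply, M3, chi41, chi311]; ring
  rw [he] at h1
  exact isIrrChar_of_zero_or_isCharacter h1 classInner_chi311_chi311

/-- Degrees: `ψ₄(1) = 4`. [cite: JamesLiebeck2001, Example 19.16] -/
theorem chi41_one : chi41 1 = ((4 : ℕ) : ℂ) := by
  have : fixN 1 = 5 := by decide
  simp only [chi41, this]; norm_num

/-- `ψ₄'(1) = 4`. [cite: JamesLiebeck2001, Example 19.16] -/
theorem chi2111_one : chi2111 1 = ((4 : ℕ) : ℂ) := by
  have h5 : fixN 1 = 5 := by decide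
  have hs : sgnZ 1 = 1 := by simp [sgnZ]
  simp only [chi2111, h5, hs]; norm_num

/-- `ψ₅(1) = 5`. [cite: JamesLiebeck2001, Example 19.16] -/
theorem chi32_one : chi32 1 = ((5 : ℕ) : ℂ) := by
  have h5 : fixN 1 = 5 := by decide
  have hT : TN2 1 = 120 := by decide
  simp only [chi32, h5, hT]; norm_num

/-- `ψ₅'(1) = 5`. [cite: JamesLiebeck2001, Example 19.16] -/
theorem chi221_one : chi221 1 = ((5 : ℕ) : ℂ) := by
  have h5 : fixN 1 = 5 := by decide
  have hT : TN2 1 = 120 := by decide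
  have hs : sgnZ 1 = 1 := by simp [sgnZ]
  simp only [chi221, h5, hT, hs]; norm_num

/-- `ψ₆(1) = 6`. [cite: JamesLiebeck2001, Example 19.16] -/
theorem chi311_one : chi311 1 = ((6 : ℕ) : ℂ) := by
  have h5 : fixN 1 = 5 := by decide
  have hT : TN3 1 = 120 := by decide
  simp only [chi311, h5, hT]; norm_num

/-! #### Decompositions of the monomial characters -/

/-- `M₁ = 1 + ψ₄`. [cite: JamesLiebeck2001, Example 19.16] -/
private theorem M1_eq : M1 = 1 + chi41 := by
  funext g; simp only [M1, chi41, Pi.add_apply, Pi.one_apply]; ring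

/-- `M₁' = sgn + ψ₄'`. [cite: JamesLiebeck2001, Example 19.16] -/
private theorem M1s_eq : M1s = sgnR + chi2111 := by
  funext g; simp only [M1s, sgnR, chi2111, Pi.add_apply]; ring

/-- `M₂ = 1 + ψ₄ + ψ₅`. [cite: JamesLiebeck2001, Example 19.16] -/
private theorem M2_eq : M2 = 1 + chi41 + chi32 := by
  funext g; simp only [M2, chi41, chi32, Pi.add_apply, Pi.one_apply]; ring

/-- `M₂' = sgn + ψ₄' + ψ₅'`. [cite: JamesLiebeck2001, Example 19.16] -/
private theorem M2s_eq : M2s = sgnR + chi2111 + chi221 := by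
  funext g; simp only [M2s, sgnR, chi2111, chi221, Pi.add_apply]; ring

/-- `M₃ = ψ₄ + ψ₆`. [cite: JamesLiebeck2001, Example 19.16] -/
private theorem M3_eq : M3 = chi41 + chi311 := by
  funext g; simp only [M3, chi41, chi311, Pi.add_apply]; ring

/-- `sgn · ψ₆ = ψ₆` (`ψ₆` vanishes on the odd classes), pointwise on the integer table.
[cite: JamesLiebeck2001, Example 19.16] -/
private theorem sgn_chi311_table :
    ∀ g : Perm5, sgnZ g * (TN3 g - 12 * (fixN g : ℤ) + 12) = TN3 g - 12 * (fixN g : ℤ) + 12 := by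
  decide +kernel

/-- `M₃' = ψ₄' + ψ₆`. [cite: JamesLiebeck2001, Example 19.16] -/
private theorem M3s_eq : M3s = chi2111 + chi311 := by
  funext g
  simp only [M3s, chi2111, chi311, Pi.add_apply]
  have h := sgn_chi311_table g
  have h' : ((sgnZ g * (TN3 g - 12 * (fixN g : ℤ) + 12) : ℤ) : ℂ) =
      ((TN3 g - 12 * (fixN g : ℤ) + 12 : ℤ) : ℂ) := by rw [h]
  push_cast at h'
  linear_combination h' / 12

/-! #### The two class-function identities, in scalar-product form -/

/-- For a class function `χ` on `S₅`:
`χ(1) = −4(⟨χ, M₁⟩ + ⟨χ, M₁'⟩) + 5(⟨χ, M₂⟩ + ⟨χ, M₂'⟩) + 3(⟨χ, M₃⟩ + ⟨χ, M₃'⟩)`.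
[cite: JamesLiebeck2001, Example 19.16] -/
theorem apply_one_eq_combination {χ : Perm5 → ℂ} (hχ : IsClassFun χ) :
    χ 1 = -4 * (classInner χ M1 + classInner χ M1s) + 5 * (classInner χ M2 + classInner χ M2s) +
      3 * (classInner χ M3 + classInner χ M3s) := by
  have hreg : indClassFun (⊥ : Subgroup Perm5) (fun h => ((1 : (⊥ : Subgroup Perm5) →* ℂˣ) h : ℂ)) =
      (-4 : ℂ) • (M1 + M1s) + (5 : ℂ) • (M2 + M2s) + (3 : ℂ) • (M3 + M3s) := by
    funext s
    rw [indClassFun_bot_apply', card_G]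
    simp only [Pi.add_apply, Pi.smul_apply, smul_eq_mul, M1, M1s, M2, M2s, M3, M3s]
    have h := reg_identity s
    have h' : ((if s = 1 then (1440 : ℤ) else 0 : ℤ) : ℂ) =
        ((-48 * ((fixN s : ℤ) + sgnZ s * (fixN s : ℤ)) + 5 * ((TN2 s : ℤ) + sgnZ s * (TN2 s : ℤ)) +
          3 * (TN3 s + sgnZ s * TN3 s) : ℤ) : ℂ) := by rw [h]
    push_cast at h'
    split_ifs at h' ⊢ with hs
    · linear_combination h' / 12
    · linear_combination h' / 12
  rw [← classInner_indClassFun_bot' χ hχ, hreg, classInner_add_right', classInner_add_right',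
    classInner_smul_right', classInner_smul_right', classInner_smul_right', classInner_add_right',
    classInner_add_right', classInner_add_right']

/-- For a class function `χ` on `S₅`:
`⟨χ, M₃⟩ − ⟨χ, M₃'⟩ = ⟨χ, M₁⟩ − ⟨χ, M₁'⟩ − ⟨χ, 1⟩ + ⟨χ, sgn⟩`. [cite: JamesLiebeck2001, Example 19.16] -/
theorem classInner_M3_sub (χ : Perm5 → ℂ) :
    classInner χ M3 - classInner χ M3s =
      classInner χ M1 - classInner χ M1s - classInner χ 1 + classInner χ sgnR := by
  have hid : M3 - M3s = M1 - M1s - 1 + sgnR := by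
    funext s
    simp only [Pi.add_apply, Pi.sub_apply, Pi.one_apply, M1, M1s, M3, M3s, sgnR]
    have h := diff_identity s
    have h' : ((TN3 s - sgnZ s * TN3 s : ℤ) : ℂ) =
        ((12 * (fixN s : ℤ) - 12 * (sgnZ s * (fixN s : ℤ)) - 12 + 12 * sgnZ s : ℤ) : ℂ) := by rw [h]
    push_cast at h'
    linear_combination h' / 12
  rw [← classInner_sub_right', hid, classInner_add_right', classInner_sub_right',
    classInner_sub_right']

end S5

/-! ### `S₅` is almost monomial -/

open S5 in
/-- **Booker 2006, Proposition 2.3, third group, PROVED: `S₅` is almost monomial.**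
[cite: Booker2006, §2 Proposition 2.3 p. 390] -/
theorem isAlmostMonomial_perm_fin_five : IsAlmostMonomial (Equiv.Perm (Fin 5)) := by
  intro ρ hρ χ₁ hχ₁ χ₂ hχ₂ h₁ h₂ hsum
  have hρ' : IsIrrChar Perm5 ρ := hρ
  have hcl : IsClassFun χ₁ := isClassFun_of_mem_virtChars hχ₁
  obtain ⟨d, -, hd⟩ := hρ'.exists_apply_one
  by_cases hd3 : d ≤ 3
  · exact eq_zero_or_eq_zero_of_split_of_apply_one_le_three hρ' hχ₁ hχ₂ h₁ h₂ hsum hd hd3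
  -- the degrees of `χ₁`, `χ₂`
  obtain ⟨N, hN⟩ := h₁.exists_nat_apply_one_eq hχ₁
  obtain ⟨N', hN'⟩ := h₂.exists_nat_apply_one_eq hχ₂
  have hNN : N + N' = d := by
    have h := congrFun hsum 1
    rw [Pi.add_apply, hd, hN, hN'] at h
    exact_mod_cast h.symm
  -- the six scalar products `nᵢ ≤ mᵢ`
  obtain ⟨n₁, k₁, m₁, hn₁, -, hm₁, hnm₁⟩ :=
    exists_nat_classInner_of_split hρ' hχ₁ hχ₂ h₁ h₂ hsum (stabilizer Perm5 (0 : Fin 5)) 1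
  obtain ⟨n₁', k₁', m₁', hn₁', -, hm₁', hnm₁'⟩ :=
    exists_nat_classInner_of_split hρ' hχ₁ hχ₂ h₁ h₂ hsum (stabilizer Perm5 (0 : Fin 5)) theta1s
  obtain ⟨n₂, k₂, m₂, hn₂, -, hm₂, hnm₂⟩ :=
    exists_nat_classInner_of_split hρ' hχ₁ hχ₂ h₁ h₂ hsum H2 1
  obtain ⟨n₂', k₂', m₂', hn₂', -, hm₂', hnm₂'⟩ :=
    exists_nat_classInner_of_split hρ' hχ₁ hχ₂ h₁ h₂ hsum H2 theta2s
  obtain ⟨n₃, k₃, m₃, hn₃, -, hm₃, hnm₃⟩ :=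
    exists_nat_classInner_of_split hρ' hχ₁ hχ₂ h₁ h₂ hsum H2 theta3
  obtain ⟨n₃', k₃', m₃', hn₃', -, hm₃', hnm₃'⟩ :=
    exists_nat_classInner_of_split hρ' hχ₁ hχ₂ h₁ h₂ hsum H2 theta3s
  rw [ind_M1] at hn₁ hm₁
  rw [ind_M1s] at hn₁' hm₁'
  rw [ind_M2] at hn₂ hm₂
  rw [ind_M2s] at hn₂' hm₂'
  rw [ind_M3] at hn₃ hm₃
  rw [ind_M3s] at hn₃' hm₃'
  -- `⟨χ₁, 1⟩ = ⟨χ₁, sgn⟩ = 0` (`ρ` is non-linear)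
  have hd4 : (4 : ℕ) ≤ d := by omega
  have hne : ∀ θ : Perm5 →* ℂˣ, ρ ≠ fun g => (θ g : ℂ) := by
    intro θ h
    have h1 := congrFun h 1
    rw [hd, map_one, Units.val_one] at h1
    have : d = 1 := by exact_mod_cast h1
    omega
  have ha1 : classInner χ₁ 1 = 0 := by
    have h := classInner_coe_monoidHom_eq_zero_of_split hρ' hχ₁ hχ₂ h₁ h₂ hsum 1 (hne 1)
    have : (fun g => ((1 : Perm5 →* ℂˣ) g : ℂ)) = (1 : Perm5 → ℂ) := by funext g; simp
    rwa [this] at h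
  have has : classInner χ₁ sgnR = 0 := by
    have h := classInner_coe_monoidHom_eq_zero_of_split hρ' hχ₁ hχ₂ h₁ h₂ hsum sgnC (hne sgnC)
    have : (fun g => ((sgnC g : ℂˣ) : ℂ)) = sgnR := funext coe_sgnC
    rwa [this] at h
  -- the two identities for `χ₁`, as integer equations
  have hI := apply_one_eq_combination hcl
  rw [hN, hn₁, hn₁', hn₂, hn₂', hn₃, hn₃'] at hI
  have hI' : (N : ℤ) = -4 * (n₁ + n₁') + 5 * (n₂ + n₂') + 3 * (n₃ + n₃') := by exact_mod_cast hI
  have hII := classInner_M3_sub χ₁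
  rw [hn₃, hn₃', hn₁, hn₁', ha1, has, sub_zero, add_zero] at hII
  have hII' : (n₃ : ℤ) - n₃' = n₁ - n₁' := by exact_mod_cast hII
  -- the scalar products `mᵢ = ⟨ρ, Mᵢ⟩` by orthonormality
  have hρ1 : classInner ρ 1 = 0 := by
    rw [hρ'.classInner_eq isIrrChar_one'', if_neg]
    intro h; exact hne 1 (by rw [h]; funext g; simp)
  have hsgn_irr : IsIrrChar Perm5 sgnR := by
    have h := (isIrrChar_mul_iff_of_apply_one_eq_one (1 : Perm5 → ℂ) isCharacter_sgnR sgnR_one).mpr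
      isIrrChar_one''
    rwa [one_mul] at h
  have hρs : classInner ρ sgnR = 0 := by
    rw [hρ'.classInner_eq hsgn_irr, if_neg]
    intro h; exact hne sgnC (by rw [h]; exact (funext coe_sgnC).symm)
  -- `χ₁(1) ∈ {0, ρ(1)}`, case by case
  have key : N = 0 ∨ N = d := by
    by_cases e_chi41 : ρ = chi41
    · rw [e_chi41] at hm₁ hm₁' hm₂ hm₂' hm₃ hm₃' hd
      rw [classInner_chi41_M1] at hm₁; rw [classInner_chi41_M1s] at hm₁'
      rw [classInner_chi41_M2] at hm₂; rw [classInner_chi41_M2s] at hm₂'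
      rw [classInner_chi41_M3] at hm₃; rw [classInner_chi41_M3s] at hm₃'
      rw [chi41_one] at hd
      have f0 : m₁ = 1 := by exact_mod_cast hm₁.symm
      have f1 : m₁' = 0 := by exact_mod_cast hm₁'.symm
      have f2 : m₂ = 1 := by exact_mod_cast hm₂.symm
      have f3 : m₂' = 0 := by exact_mod_cast hm₂'.symm
      have f4 : m₃ = 1 := by exact_mod_cast hm₃.symm
      have f5 : m₃' = 0 := by exact_mod_cast hm₃'.symm
      have fd : d = 4 := by exact_mod_cast hd.symm
      have hb0 : n₁ ≤ 1 := by omega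
      have hb1 : n₂ ≤ 1 := by omega
      have hb2 : n₃ ≤ 1 := by omega
      interval_cases n₁ <;> interval_cases n₂ <;> interval_cases n₃ <;> omega
    by_cases e_chi2111 : ρ = chi2111
    · rw [e_chi2111] at hm₁ hm₁' hm₂ hm₂' hm₃ hm₃' hd
      rw [classInner_chi2111_M1] at hm₁; rw [classInner_chi2111_M1s] at hm₁'
      rw [classInner_chi2111_M2] at hm₂; rw [classInner_chi2111_M2s] at hm₂'
      rw [classInner_chi2111_M3] at hm₃; rw [classInner_chi2111_M3s] at hm₃'
      rw [chi2111_one] at hd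
      have f0 : m₁ = 0 := by exact_mod_cast hm₁.symm
      have f1 : m₁' = 1 := by exact_mod_cast hm₁'.symm
      have f2 : m₂ = 0 := by exact_mod_cast hm₂.symm
      have f3 : m₂' = 1 := by exact_mod_cast hm₂'.symm
      have f4 : m₃ = 0 := by exact_mod_cast hm₃.symm
      have f5 : m₃' = 1 := by exact_mod_cast hm₃'.symm
      have fd : d = 4 := by exact_mod_cast hd.symm
      have hb0 : n₁' ≤ 1 := by omega
      have hb1 : n₂' ≤ 1 := by omega
      have hb2 : n₃' ≤ 1 := by omega
      interval_cases n₁' <;> interval_cases n₂' <;> interval_cases n₃' <;> omega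
    by_cases e_chi32 : ρ = chi32
    · rw [e_chi32] at hm₁ hm₁' hm₂ hm₂' hm₃ hm₃' hd
      rw [classInner_chi32_M1] at hm₁; rw [classInner_chi32_M1s] at hm₁'
      rw [classInner_chi32_M2] at hm₂; rw [classInner_chi32_M2s] at hm₂'
      rw [classInner_chi32_M3] at hm₃; rw [classInner_chi32_M3s] at hm₃'
      rw [chi32_one] at hd
      have f0 : m₁ = 0 := by exact_mod_cast hm₁.symm
      have f1 : m₁' = 0 := by exact_mod_cast hm₁'.symm
      have f2 : m₂ = 1 := by exact_mod_cast hm₂.symm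
      have f3 : m₂' = 0 := by exact_mod_cast hm₂'.symm
      have f4 : m₃ = 0 := by exact_mod_cast hm₃.symm
      have f5 : m₃' = 0 := by exact_mod_cast hm₃'.symm
      have fd : d = 5 := by exact_mod_cast hd.symm
      have hb0 : n₂ ≤ 1 := by omega
      interval_cases n₂ <;> omega
    by_cases e_chi221 : ρ = chi221
    · rw [e_chi221] at hm₁ hm₁' hm₂ hm₂' hm₃ hm₃' hd
      rw [classInner_chi221_M1] at hm₁; rw [classInner_chi221_M1s] at hm₁'
      rw [classInner_chi221_M2] at hm₂; rw [classInner_chi221_M2s] at hm₂'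
      rw [classInner_chi221_M3] at hm₃; rw [classInner_chi221_M3s] at hm₃'
      rw [chi221_one] at hd
      have f0 : m₁ = 0 := by exact_mod_cast hm₁.symm
      have f1 : m₁' = 0 := by exact_mod_cast hm₁'.symm
      have f2 : m₂ = 0 := by exact_mod_cast hm₂.symm
      have f3 : m₂' = 1 := by exact_mod_cast hm₂'.symm
      have f4 : m₃ = 0 := by exact_mod_cast hm₃.symm
      have f5 : m₃' = 0 := by exact_mod_cast hm₃'.symm
      have fd : d = 5 := by exact_mod_cast hd.symm
      have hb0 : n₂' ≤ 1 := by omega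
      interval_cases n₂' <;> omega
    by_cases e_chi311 : ρ = chi311
    · rw [e_chi311] at hm₁ hm₁' hm₂ hm₂' hm₃ hm₃' hd
      rw [classInner_chi311_M1] at hm₁; rw [classInner_chi311_M1s] at hm₁'
      rw [classInner_chi311_M2] at hm₂; rw [classInner_chi311_M2s] at hm₂'
      rw [classInner_chi311_M3] at hm₃; rw [classInner_chi311_M3s] at hm₃'
      rw [chi311_one] at hd
      have f0 : m₁ = 0 := by exact_mod_cast hm₁.symm
      have f1 : m₁' = 0 := by exact_mod_cast hm₁'.symm
      have f2 : m₂ = 0 := by exact_mod_cast hm₂.symm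
      have f3 : m₂' = 0 := by exact_mod_cast hm₂'.symm
      have f4 : m₃ = 1 := by exact_mod_cast hm₃.symm
      have f5 : m₃' = 1 := by exact_mod_cast hm₃'.symm
      have fd : d = 6 := by exact_mod_cast hd.symm
      have hb0 : n₃ ≤ 1 := by omega
      have hb1 : n₃' ≤ 1 := by omega
      interval_cases n₃ <;> interval_cases n₃' <;> omega
    -- `ρ` is none of the five: all `mᵢ = 0`
    have g41 : classInner ρ chi41 = 0 := by rw [hρ'.classInner_eq isIrrChar_chi41, if_neg e_chi41]
    have g2111 : classInner ρ chi2111 = 0 := by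
      rw [hρ'.classInner_eq isIrrChar_chi2111, if_neg e_chi2111]
    have g32 : classInner ρ chi32 = 0 := by rw [hρ'.classInner_eq isIrrChar_chi32, if_neg e_chi32]
    have g221 : classInner ρ chi221 = 0 := by
      rw [hρ'.classInner_eq isIrrChar_chi221, if_neg e_chi221]
    have g311 : classInner ρ chi311 = 0 := by
      rw [hρ'.classInner_eq isIrrChar_chi311, if_neg e_chi311]
    rw [M1_eq, classInner_add_right', hρ1, g41] at hm₁
    rw [M1s_eq, classInner_add_right', hρs, g2111] at hm₁'
    rw [M2_eq, classInner_add_right', classInner_add_right', hρ1, g41, g32] at hm₂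
    rw [M2s_eq, classInner_add_right', classInner_add_right', hρs, g2111, g221] at hm₂'
    rw [M3_eq, classInner_add_right', g41, g311] at hm₃
    rw [M3s_eq, classInner_add_right', g2111, g311] at hm₃'
    have f0 : m₁ = 0 := by exact_mod_cast hm₁.symm
    have f1 : m₁' = 0 := by exact_mod_cast hm₁'.symm
    have f2 : m₂ = 0 := by exact_mod_cast hm₂.symm
    have f3 : m₂' = 0 := by exact_mod_cast hm₂'.symm
    have f4 : m₃ = 0 := by exact_mod_cast hm₃.symm
    have f5 : m₃' = 0 := by exact_mod_cast hm₃'.symm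
    omega
  refine eq_zero_or_eq_zero_of_split_of_apply_one hχ₁ hχ₂ h₁ h₂ hsum ?_
  rcases key with h0 | hdd
  · left; rw [hN, h0, Nat.cast_zero]
  · right; rw [hN, hdd, hd]

end Booker2006

end Literature.NumberTheory.LFunctions

end
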